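import Literature.NumberTheory.Automorphic.KirillovShapeProductMellinGL2
import Literature.NumberTheory.Automorphic.ArchHeckeTestVectorConstructionGL2
import HarnessLib

/-!
# The local Gamma bookkeeping of the archimedean `GL₂ × GL₂` Rankin–Selberg integral: Tate's factor
# cancels the denominators of the `exp × K`, `K × K` and radial `K × K` Mellin transforms EXACTLY
# (Jacquet (1972), §17–§19; Humphries–Jo (2024), Thm. 5.6, Prop. 5.8)

Topic `NumberTheory/Automorphic`; namespace `Literature.NumberTheory.Automorphic`. Theorems only (no
definition, no named fact, no instance). After the torus reduction (`ArchRankinSelbergTorusReductionGL2`) and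
the evaluation of the `K_∞`-average by a reproducing kernel (Humphries–Jo, Prop. 5.2), the archimedean
Rankin–Selberg integral of two tagged test vectors is `T(s) · M(s)` with `T` Tate's factor of a radial Gaussian
monomial (`ArchRankinSelbergTateFactorGL2`: `∏_{w real} Γ_ℝ(2s + p_w) ∏_{w complex} (π/2) 2^{2s+q_w/2} Γ_ℂ(2s + q_w/2)`)
and `M` the Mellin transform over `K_∞ˣ` of the product `W_e conj W'_{e'}` of the two Kirillov functions, a product
over the places of `S_t conj S'_{t'}` for the shape functions `realShapeOf`, `complexShapeOf` of the tags
(`ArchHeckeTestVectorConstructionGL2`). This file does the LOCAL bookkeeping, in the class of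
**Rankin–Selberg Gamma products on `re s > 1`**: functions equal there to
`A c^s ∏ Γ_ℝ(s + a_j) ∏ Γ_ℂ(s + b_j)` with `A ≠ 0`, `c > 0`, `re a_j, re b_j > -1` (the target shape of
`HumphriesJo2024_archRankinSelberg_testVector`, up to the constant `A` absorbed by rescaling a test vector;
spelled out inline — no definition):

* §1 the class is closed under products and contains `A r^{ps+q}` (`p` real), `Γ_ℝ(s+c)`, `Γ_ℂ(s+c)`, `Γ(s+c)`,
  `Γ((s+c)/2)` for `re c > -1` (`rsGammaProduct_mul`, `…_const_mul_cpow`, `…_Gamma_shift`, …);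
* §2 real places, profiles on `(0,∞)` with `B = β + β'` (Tate's exponent `p_w = 2B`, i.e. the weight degree is
  `p + p'` for `β = (μ+p)/2`): `rsGammaProduct_local_exp_exp` (`re B > 0`; `Γ(s+B)Γ(s+B-1)`),
  `rsGammaProduct_local_exp_bessel` / `…_bessel_exp` (`|im ν'| < re B + ½`; Tate's `Γ(s+B) = Γ(z+½)` cancels the
  denominator of `integral_expShape_mul_besselShape_mul_cpow`), `rsGammaProduct_local_bessel_bessel`
  (`|im ν| + |im ν'| < re B + 1`; `Γ(s+B) = Γ(z)` cancels the denominator of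
  `integral_besselShape_mul_besselShape_mul_cpow`), each with integrability on `re s > 1`;
* §3 complex places: `rsGammaProduct_local_complex` (`q_w = 2B - 2`; `Γ_ℂ(2s + q_w/2) = Γ_ℂ(z')` cancels the
  denominator of `integral_complex_besselShape_mul_besselShape`);
* §4 the shape functions of the tags: `rsGammaProduct_local_realShapeFn` (`∫_ℝ S conj S' |x|^{s-2}
  = (c₊ conj c'₊ + c₋ conj c'₋) ∫₀^∞ Φ conj Φ' u^{s-2}`), `rsGammaProduct_local_complex_conj`, and the two
  case analyses **`rsGammaProduct_local_realTag`** (16 pairs of real tags, under `re μ = 0`, `re κ = 0`,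
  `|im ν| < ½` — `ArchUnitarityBoundsGL2Real`) and **`rsGammaProduct_local_complexTag`** (9 pairs of complex
  tags, under `re μ₁ = 0`, `|im ν^a|, |im ν^h| < m/2 + 1`, `im ν^a = m/2` on strings —
  `ArchUnitarityBoundsGL2Complex`).

The global assembly over the places (Fubini on `K_∞ˣ`, Tate's factor) is the companion
`ArchRankinSelbergGammaBookkeepingGL2`.

## References

* H. Jacquet, *Automorphic Forms on GL(2), Part II*, LNM 278 (1972), §17–§19 [Jacquet1972GL2II].
* P. Humphries, Y. Jo, *Test vectors for archimedean period integrals*, Publ. Mat. 68 (2024), Thm. 5.6,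
  Prop. 5.8 [HumphriesJo2024].
* H. Jacquet, R. P. Langlands, *Automorphic Forms on GL(2)*, LNM 114 (1970), §5 Thm. 5.15, §6 Thm. 6.4
  [JacquetLanglands1970].
-/

noncomputable section

open MeasureTheory Measure Set Filter
open scoped Topology ComplexConjugate

namespace Literature.NumberTheory.Automorphic

open Literature.Analysis.FunctionSpaces

/-! ### 1. Rankin–Selberg Gamma products: `A c^s ∏ Γ_ℝ(s + a_j) ∏ Γ_ℂ(s + b_j)` on `re s > 1`,
`A ≠ 0`, `c > 0`, `re a_j, re b_j > -1` -/

section RSGamma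

variable {f g : ℂ → ℂ}

/-- Products of Rankin–Selberg Gamma products (concatenate the shifts). [folklore] -/
theorem rsGammaProduct_mul
    (hf : ∃ (A : ℂ) (c : ℝ) (d₁ d₂ : ℕ) (a : Fin d₁ → ℂ) (b : Fin d₂ → ℂ), A ≠ 0 ∧ 0 < c ∧ (∀ j, -1 < (a j).re) ∧
      (∀ j, -1 < (b j).re) ∧ ∀ s : ℂ, 1 < s.re →
        f s = A * (c : ℂ) ^ s * ((∏ j, Complex.Gammaℝ (s + a j)) * ∏ j, Complex.Gammaℂ (s + b j)))
    (hg : ∃ (A : ℂ) (c : ℝ) (d₁ d₂ : ℕ) (a : Fin d₁ → ℂ) (b : Fin d₂ → ℂ), A ≠ 0 ∧ 0 < c ∧ (∀ j, -1 < (a j).re) ∧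
      (∀ j, -1 < (b j).re) ∧ ∀ s : ℂ, 1 < s.re →
        g s = A * (c : ℂ) ^ s * ((∏ j, Complex.Gammaℝ (s + a j)) * ∏ j, Complex.Gammaℂ (s + b j))) :
    ∃ (A : ℂ) (c : ℝ) (d₁ d₂ : ℕ) (a : Fin d₁ → ℂ) (b : Fin d₂ → ℂ), A ≠ 0 ∧ 0 < c ∧ (∀ j, -1 < (a j).re) ∧
      (∀ j, -1 < (b j).re) ∧ ∀ s : ℂ, 1 < s.re →
        f s * g s = A * (c : ℂ) ^ s * ((∏ j, Complex.Gammaℝ (s + a j)) * ∏ j, Complex.Gammaℂ (s + b j)) := by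
  obtain ⟨A, c, d₁, d₂, a, b, hA, hc, ha, hb, hf⟩ := hf
  obtain ⟨A', c', d₁', d₂', a', b', hA', hc', ha', hb', hg⟩ := hg
  refine ⟨A * A', c * c', d₁ + d₁', d₂ + d₂', Fin.append a a', Fin.append b b', mul_ne_zero hA hA', mul_pos hc hc',
    fun j => ?_, fun j => ?_, fun s hs => ?_⟩
  · refine Fin.addCases (fun i => ?_) (fun i => ?_) j
    · rw [Fin.append_left]; exact ha i
    · rw [Fin.append_right]; exact ha' i
  · refine Fin.addCases (fun i => ?_) (fun i => ?_) j
    · rw [Fin.append_left]; exact hb i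
    · rw [Fin.append_right]; exact hb' i
  · rw [hf s hs, hg s hs, Fin.prod_univ_add, Fin.prod_univ_add]
    simp only [Fin.append_left, Fin.append_right]
    rw [Complex.ofReal_mul, Complex.mul_cpow_ofReal_nonneg hc.le hc'.le]
    ring

/-- A function agreeing with a Rankin–Selberg Gamma product on `re s > 1` is one. [folklore] -/
theorem rsGammaProduct_congr
    (hf : ∃ (A : ℂ) (c : ℝ) (d₁ d₂ : ℕ) (a : Fin d₁ → ℂ) (b : Fin d₂ → ℂ), A ≠ 0 ∧ 0 < c ∧ (∀ j, -1 < (a j).re) ∧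
      (∀ j, -1 < (b j).re) ∧ ∀ s : ℂ, 1 < s.re →
        f s = A * (c : ℂ) ^ s * ((∏ j, Complex.Gammaℝ (s + a j)) * ∏ j, Complex.Gammaℂ (s + b j)))
    (hfg : ∀ s : ℂ, 1 < s.re → g s = f s) :
    ∃ (A : ℂ) (c : ℝ) (d₁ d₂ : ℕ) (a : Fin d₁ → ℂ) (b : Fin d₂ → ℂ), A ≠ 0 ∧ 0 < c ∧ (∀ j, -1 < (a j).re) ∧
      (∀ j, -1 < (b j).re) ∧ ∀ s : ℂ, 1 < s.re →
        g s = A * (c : ℂ) ^ s * ((∏ j, Complex.Gammaℝ (s + a j)) * ∏ j, Complex.Gammaℂ (s + b j)) := by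
  obtain ⟨A, c, d₁, d₂, a, b, hA, hc, ha, hb, hf⟩ := hf
  exact ⟨A, c, d₁, d₂, a, b, hA, hc, ha, hb, fun s hs => (hfg s hs).trans (hf s hs)⟩

/-- `A r^{ps + q}` (`A ≠ 0`, `r > 0`, `p` real) is a Rankin–Selberg Gamma product (`c = r^p`). [folklore] -/
theorem rsGammaProduct_const_mul_cpow {A : ℂ} (hA : A ≠ 0) {r : ℝ} (hr : 0 < r) (p : ℝ) (q : ℂ) :
    ∃ (A' : ℂ) (c : ℝ) (d₁ d₂ : ℕ) (a : Fin d₁ → ℂ) (b : Fin d₂ → ℂ), A' ≠ 0 ∧ 0 < c ∧ (∀ j, -1 < (a j).re) ∧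
      (∀ j, -1 < (b j).re) ∧ ∀ s : ℂ, 1 < s.re →
        A * (r : ℂ) ^ ((p : ℂ) * s + q) = A' * (c : ℂ) ^ s * ((∏ j, Complex.Gammaℝ (s + a j)) * ∏ j, Complex.Gammaℂ (s + b j)) := by
  have hr0 : (r : ℂ) ≠ 0 := Complex.ofReal_ne_zero.mpr hr.ne'
  refine ⟨A * (r : ℂ) ^ q, r ^ p, 0, 0, Fin.elim0, Fin.elim0, mul_ne_zero hA ?_, Real.rpow_pos_of_pos hr p,
    fun j => Fin.elim0 j, fun j => Fin.elim0 j, fun s _ => ?_⟩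
  · rw [Ne, Complex.cpow_eq_zero_iff, not_and_or]
    exact Or.inl hr0
  · simp only [Finset.univ_eq_empty, Finset.prod_empty, mul_one]
    have hrp : 0 < r ^ p := Real.rpow_pos_of_pos hr p
    have e : (((r ^ p : ℝ)) : ℂ) ^ s = (r : ℂ) ^ ((p : ℂ) * s) := by
      rw [Complex.cpow_def_of_ne_zero (Complex.ofReal_ne_zero.2 hrp.ne'), Complex.cpow_def_of_ne_zero hr0,
        ← Complex.ofReal_log hrp.le, Real.log_rpow hr, ← Complex.ofReal_log hr.le]
      push_cast
      ring_nf
    rw [Complex.cpow_add _ _ hr0, e]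
    ring

/-- A non-zero constant is a Rankin–Selberg Gamma product. [folklore] -/
theorem rsGammaProduct_const {A : ℂ} (hA : A ≠ 0) :
    ∃ (A' : ℂ) (c : ℝ) (d₁ d₂ : ℕ) (a : Fin d₁ → ℂ) (b : Fin d₂ → ℂ), A' ≠ 0 ∧ 0 < c ∧ (∀ j, -1 < (a j).re) ∧
      (∀ j, -1 < (b j).re) ∧ ∀ s : ℂ, 1 < s.re →
        (fun _ : ℂ => A) s = A' * (c : ℂ) ^ s * ((∏ j, Complex.Gammaℝ (s + a j)) * ∏ j, Complex.Gammaℂ (s + b j)) :=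
  rsGammaProduct_congr (rsGammaProduct_const_mul_cpow hA one_pos 0 0) fun s _ => by
    simp

/-- `Γ_ℝ(s + c)` with `re c > -1` is a Rankin–Selberg Gamma product. [folklore] -/
theorem rsGammaProduct_Gammaℝ_shift {c : ℂ} (hc : -1 < c.re) :
    ∃ (A : ℂ) (c' : ℝ) (d₁ d₂ : ℕ) (a : Fin d₁ → ℂ) (b : Fin d₂ → ℂ), A ≠ 0 ∧ 0 < c' ∧ (∀ j, -1 < (a j).re) ∧
      (∀ j, -1 < (b j).re) ∧ ∀ s : ℂ, 1 < s.re →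
        Complex.Gammaℝ (s + c) = A * (c' : ℂ) ^ s * ((∏ j, Complex.Gammaℝ (s + a j)) * ∏ j, Complex.Gammaℂ (s + b j)) := by
  refine ⟨1, 1, 1, 0, fun _ => c, Fin.elim0, one_ne_zero, one_pos, fun _ => hc, fun j => Fin.elim0 j, fun s _ => ?_⟩
  simp

/-- `Γ_ℂ(s + c)` with `re c > -1` is a Rankin–Selberg Gamma product. [folklore] -/
theorem rsGammaProduct_Gammaℂ_shift {c : ℂ} (hc : -1 < c.re) :
    ∃ (A : ℂ) (c' : ℝ) (d₁ d₂ : ℕ) (a : Fin d₁ → ℂ) (b : Fin d₂ → ℂ), A ≠ 0 ∧ 0 < c' ∧ (∀ j, -1 < (a j).re) ∧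
      (∀ j, -1 < (b j).re) ∧ ∀ s : ℂ, 1 < s.re →
        Complex.Gammaℂ (s + c) = A * (c' : ℂ) ^ s * ((∏ j, Complex.Gammaℝ (s + a j)) * ∏ j, Complex.Gammaℂ (s + b j)) := by
  refine ⟨1, 1, 0, 1, Fin.elim0, fun _ => c, one_ne_zero, one_pos, fun j => Fin.elim0 j, fun _ => hc, fun s _ => ?_⟩
  simp

/-- `Γ(s + c) = ½ (2π)^{s+c} Γ_ℂ(s + c)` with `re c > -1` is a Rankin–Selberg Gamma product. [folklore] -/
theorem rsGammaProduct_Gamma_shift {c : ℂ} (hc : -1 < c.re) :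
    ∃ (A : ℂ) (c' : ℝ) (d₁ d₂ : ℕ) (a : Fin d₁ → ℂ) (b : Fin d₂ → ℂ), A ≠ 0 ∧ 0 < c' ∧ (∀ j, -1 < (a j).re) ∧
      (∀ j, -1 < (b j).re) ∧ ∀ s : ℂ, 1 < s.re →
        Complex.Gamma (s + c) = A * (c' : ℂ) ^ s * ((∏ j, Complex.Gammaℝ (s + a j)) * ∏ j, Complex.Gammaℂ (s + b j)) := by
  have h2π : (0 : ℝ) < 2 * Real.pi := by positivity
  refine rsGammaProduct_congr (rsGammaProduct_mul (rsGammaProduct_const_mul_cpow (A := 1 / 2) (by norm_num) h2π 1 c)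
    (rsGammaProduct_Gammaℂ_shift hc)) fun s _ => ?_
  rw [Complex.Gammaℂ_def, Complex.cpow_neg, show ((2 * Real.pi : ℝ) : ℂ) = 2 * Real.pi by push_cast; rfl]
  have hne : (2 * Real.pi : ℂ) ^ (s + c) ≠ 0 := by
    rw [Ne, Complex.cpow_eq_zero_iff, not_and_or]
    exact Or.inl (by exact_mod_cast h2π.ne')
  push_cast
  rw [one_mul]
  field_simp

/-- `Γ((s + c)/2) = π^{(s+c)/2} Γ_ℝ(s + c)` with `re c > -1` is a Rankin–Selberg Gamma product. [folklore] -/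
theorem rsGammaProduct_Gamma_half_shift {c : ℂ} (hc : -1 < c.re) :
    ∃ (A : ℂ) (c' : ℝ) (d₁ d₂ : ℕ) (a : Fin d₁ → ℂ) (b : Fin d₂ → ℂ), A ≠ 0 ∧ 0 < c' ∧ (∀ j, -1 < (a j).re) ∧
      (∀ j, -1 < (b j).re) ∧ ∀ s : ℂ, 1 < s.re →
        Complex.Gamma ((s + c) / 2) = A * (c' : ℂ) ^ s * ((∏ j, Complex.Gammaℝ (s + a j)) * ∏ j, Complex.Gammaℂ (s + b j)) := by
  refine rsGammaProduct_congr (rsGammaProduct_mul (rsGammaProduct_const_mul_cpow (A := 1) one_ne_zero Real.pi_pos (1 / 2) (c / 2))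
    (rsGammaProduct_Gammaℝ_shift hc)) fun s _ => ?_
  rw [Complex.Gammaℝ_def, one_mul, show -(s + c) / 2 = -((((1 / 2 : ℝ) : ℂ)) * s + c / 2) by push_cast; ring, Complex.cpow_neg]
  have hne : (Real.pi : ℂ) ^ ((((1 / 2 : ℝ) : ℂ)) * s + c / 2) ≠ 0 := by
    rw [Ne, Complex.cpow_eq_zero_iff, not_and_or]
    exact Or.inl (by exact_mod_cast Real.pi_pos.ne')
  rw [show (s + c) / 2 = (((1 / 2 : ℝ) : ℂ)) * s + c / 2 by push_cast; ring]
  field_simp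

/-- Finite products of Rankin–Selberg Gamma products. [folklore] -/
theorem rsGammaProduct_finset_prod {ι : Type*} (S : Finset ι) {F : ι → ℂ → ℂ}
    (h : ∀ i ∈ S, ∃ (A : ℂ) (c : ℝ) (d₁ d₂ : ℕ) (a : Fin d₁ → ℂ) (b : Fin d₂ → ℂ), A ≠ 0 ∧ 0 < c ∧ (∀ j, -1 < (a j).re) ∧
      (∀ j, -1 < (b j).re) ∧ ∀ s : ℂ, 1 < s.re →
        F i s = A * (c : ℂ) ^ s * ((∏ j, Complex.Gammaℝ (s + a j)) * ∏ j, Complex.Gammaℂ (s + b j))) :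
    ∃ (A : ℂ) (c : ℝ) (d₁ d₂ : ℕ) (a : Fin d₁ → ℂ) (b : Fin d₂ → ℂ), A ≠ 0 ∧ 0 < c ∧ (∀ j, -1 < (a j).re) ∧
      (∀ j, -1 < (b j).re) ∧ ∀ s : ℂ, 1 < s.re →
        (∏ i ∈ S, F i s) = A * (c : ℂ) ^ s * ((∏ j, Complex.Gammaℝ (s + a j)) * ∏ j, Complex.Gammaℂ (s + b j)) := by
  classical
  induction S using Finset.induction_on with
  | empty =>
    exact rsGammaProduct_congr (rsGammaProduct_const one_ne_zero) fun s _ => by rw [Finset.prod_empty]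
  | @insert i S hi ih =>
    refine rsGammaProduct_congr (rsGammaProduct_mul (h i (Finset.mem_insert_self _ _))
      (ih fun j hj => h j (Finset.mem_insert_of_mem hj))) fun s _ => ?_
    rw [Finset.prod_insert hi]

end RSGamma

/-! ### 2. The local products on `(0, ∞)`: `Γ_ℝ(2s + 2B) · ∫₀^∞ Φ(u) Φ'(u) u^{s-2} du` -/

section HalfLine

/-- **`exp × exp`** (discrete series × discrete series at a real place): for `B = β + β'` with `re B > 0`,
`Γ_ℝ(2s + 2B) ∫₀^∞ u^β e^{-2πu} u^{β'} e^{-2πu} u^{s-2} du = π^{-(s+B)} Γ(s+B) (4π)^{1-s-B} Γ(s+B-1)` is a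
Rankin–Selberg Gamma product on `re s > 1` (shifts `B`, `B - 1` of real part `> -1`), with integrability.
[cite: Jacquet1972GL2II, §17–§19] -/
theorem rsGammaProduct_local_exp_exp {β β' : ℂ} (hB : 0 < (β + β').re) :
    (∀ s : ℂ, 1 < s.re → IntegrableOn (fun u : ℝ => expShape β (2 * Real.pi) u * expShape β' (2 * Real.pi) u * (u : ℂ) ^ (s - 2)) (Ioi 0)) ∧
    ∃ (A : ℂ) (c : ℝ) (d₁ d₂ : ℕ) (a : Fin d₁ → ℂ) (b : Fin d₂ → ℂ), A ≠ 0 ∧ 0 < c ∧ (∀ j, -1 < (a j).re) ∧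
      (∀ j, -1 < (b j).re) ∧ ∀ s : ℂ, 1 < s.re →
        Complex.Gammaℝ (2 * s + 2 * (β + β')) *
            ∫ u in Ioi (0 : ℝ), expShape β (2 * Real.pi) u * expShape β' (2 * Real.pi) u * (u : ℂ) ^ (s - 2) =
          A * (c : ℂ) ^ s * ((∏ j, Complex.Gammaℝ (s + a j)) * ∏ j, Complex.Gammaℂ (s + b j)) := by
  set B : ℂ := β + β' with hBdef
  have h4π : (0 : ℝ) < 4 * Real.pi := by positivity
  have hpt : ∀ s : ℂ, EqOn (fun u : ℝ => expShape β (2 * Real.pi) u * expShape β' (2 * Real.pi) u * (u : ℂ) ^ (s - 2))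
      (fun u : ℝ => expShape B (4 * Real.pi) u * (u : ℂ) ^ ((s - 1 / 2) - 3 / 2)) (Ioi 0) := fun s u hu => by
    simp only []
    rw [expShape_mul_expShape hu, show (2 * Real.pi + 2 * Real.pi : ℝ) = 4 * Real.pi by ring,
      show s - 1 / 2 - 3 / 2 = s - 2 by ring]
  have hre : ∀ s : ℂ, 1 < s.re → 0 < ((s - 1 / 2) + B - 1 / 2).re := fun s hs => by
    simp only [Complex.add_re, Complex.sub_re, Complex.div_ofNat_re, Complex.one_re]
    linarith
  refine ⟨fun s hs => (integrableOn_expShape_mul h4π (hre s hs)).congr_fun (hpt s).symm measurableSet_Ioi, ?_⟩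
  have hB1 : -1 < B.re := by linarith
  have hB2 : -1 < (B - 1).re := by rw [Complex.sub_re, Complex.one_re]; linarith
  refine rsGammaProduct_congr (rsGammaProduct_mul (rsGammaProduct_mul (rsGammaProduct_mul
    (rsGammaProduct_const_mul_cpow one_ne_zero Real.pi_pos (-1) (-B))
    (rsGammaProduct_const_mul_cpow one_ne_zero (one_div_pos.mpr h4π) 1 (B - 1)))
    (rsGammaProduct_Gamma_shift hB1)) (rsGammaProduct_Gamma_shift hB2)) fun s hs => ?_
  rw [setIntegral_congr_fun measurableSet_Ioi (hpt s), integral_expShape_mul h4π (hre s hs), Complex.Gammaℝ_def,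
    show -(2 * s + 2 * B) / 2 = ((-1 : ℝ) : ℂ) * s + -B by push_cast; ring,
    show (2 * s + 2 * B) / 2 = s + B by ring,
    show s - 1 / 2 + B - 1 / 2 = ((1 : ℝ) : ℂ) * s + (B - 1) by push_cast; ring,
    show s + (B - 1) = ((1 : ℝ) : ℂ) * s + (B - 1) by push_cast; ring]
  push_cast
  ring

/-- **`exp × K`** (discrete series × principal series at a real place): for `B = β + β'` and
`|im ν'| < re B + ½`, `Γ_ℝ(2s + 2B) ∫₀^∞ u^β e^{-2πu} · u^{β'} k_{ν'}(u) · u^{s-2} du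
= 2√π π^{-(s+B)} (4π)^{-(s+B-½)} Γ(s+B-½+iν') Γ(s+B-½-iν')` (the factor `Γ(s+B) = Γ(z+½)` of Tate's
integral cancels the denominator of `integral_expShape_mul_besselShape_mul_cpow` EXACTLY) is a
Rankin–Selberg Gamma product on `re s > 1`, with integrability. [cite: Jacquet1972GL2II, §17–§19] -/
theorem rsGammaProduct_local_exp_bessel {β β' ν' : ℂ} (h : |ν'.im| < (β + β').re + 1 / 2) :
    (∀ s : ℂ, 1 < s.re →
      IntegrableOn (fun u : ℝ => expShape β (2 * Real.pi) u * besselShape β' (2 * Real.pi) ν' u * (u : ℂ) ^ (s - 2)) (Ioi 0)) ∧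
    ∃ (A : ℂ) (c : ℝ) (d₁ d₂ : ℕ) (a : Fin d₁ → ℂ) (b : Fin d₂ → ℂ), A ≠ 0 ∧ 0 < c ∧ (∀ j, -1 < (a j).re) ∧
      (∀ j, -1 < (b j).re) ∧ ∀ s : ℂ, 1 < s.re →
        Complex.Gammaℝ (2 * s + 2 * (β + β')) *
            ∫ u in Ioi (0 : ℝ), expShape β (2 * Real.pi) u * besselShape β' (2 * Real.pi) ν' u * (u : ℂ) ^ (s - 2) =
          A * (c : ℂ) ^ s * ((∏ j, Complex.Gammaℝ (s + a j)) * ∏ j, Complex.Gammaℂ (s + b j)) := by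
  set B : ℂ := β + β' with hBdef
  have h2π : (0 : ℝ) < 2 * Real.pi := by positivity
  have habs : 0 ≤ |ν'.im| := abs_nonneg _
  have hz : ∀ s : ℂ, 1 < s.re → |ν'.im| < (β + β' + (s - 2) + 3 / 2).re := fun s hs => by
    have e : (β + β' + (s - 2) + 3 / 2).re = B.re + s.re - 1 / 2 := by
      rw [hBdef]; simp only [Complex.add_re, Complex.sub_re, Complex.div_ofNat_re, Complex.re_ofNat]; ring
    rw [e]; linarith
  refine ⟨fun s hs => (integral_expShape_mul_besselShape_mul_cpow h2π (hz s hs)).1, ?_⟩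
  have hb1 : -1 < (B - 1 / 2 + Complex.I * ν').re := by
    simp only [Complex.add_re, Complex.sub_re, Complex.mul_re, Complex.I_re, Complex.I_im, Complex.div_ofNat_re,
      Complex.one_re, zero_mul, one_mul, zero_sub]
    linarith [neg_abs_le ν'.im, le_abs_self ν'.im]
  have hb2 : -1 < (B - 1 / 2 - Complex.I * ν').re := by
    simp only [Complex.sub_re, Complex.mul_re, Complex.I_re, Complex.I_im, Complex.div_ofNat_re,
      Complex.one_re, zero_mul, one_mul, zero_sub]
    linarith [neg_abs_le ν'.im, le_abs_self ν'.im]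
  have hA : (2 * (Real.sqrt Real.pi : ℂ)) ≠ 0 :=
    mul_ne_zero two_ne_zero (Complex.ofReal_ne_zero.mpr (Real.sqrt_pos.mpr Real.pi_pos).ne')
  refine rsGammaProduct_congr (rsGammaProduct_mul (rsGammaProduct_mul (rsGammaProduct_mul (rsGammaProduct_mul
    (rsGammaProduct_const_mul_cpow hA Real.pi_pos (-1) (-B))
    (rsGammaProduct_const_mul_cpow one_ne_zero h2π (-1) (-(B - 1 / 2))))
    (rsGammaProduct_const_mul_cpow one_ne_zero two_pos (-1) (-(B - 1 / 2))))
    (rsGammaProduct_Gamma_shift hb1)) (rsGammaProduct_Gamma_shift hb2)) fun s hs => ?_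
  rw [(integral_expShape_mul_besselShape_mul_cpow h2π (hz s hs)).2, Complex.Gammaℝ_def]
  -- the cancellation `Γ((2s+2B)/2) = Γ(z + ½)`
  have hΓ : Complex.Gamma (β + β' + (s - 2) + 3 / 2 + 1 / 2) ≠ 0 := by
    apply Complex.Gamma_ne_zero_of_re_pos
    have e : (β + β' + (s - 2) + 3 / 2 + 1 / 2).re = B.re + s.re := by
      rw [hBdef]; simp only [Complex.add_re, Complex.sub_re, Complex.div_ofNat_re, Complex.re_ofNat, Complex.one_re]; ring
    rw [e]; linarith
  have h2z : (2 : ℂ) ^ (β + β' + (s - 2) + 3 / 2) ≠ 0 := by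
    rw [Ne, Complex.cpow_eq_zero_iff, not_and_or]; exact Or.inl two_ne_zero
  rw [show (2 * s + 2 * B) / 2 = β + β' + (s - 2) + 3 / 2 + 1 / 2 by rw [hBdef]; ring,
    show -(2 * s + 2 * B) / 2 = ((-1 : ℝ) : ℂ) * s + -B by push_cast; ring,
    show -(β + β' + (s - 2) + 3 / 2) = ((-1 : ℝ) : ℂ) * s + -(B - 1 / 2) by rw [hBdef]; push_cast; ring,
    show β + β' + (s - 2) + 3 / 2 + Complex.I * ν' = ((1 : ℝ) : ℂ) * s + (B - 1 / 2 + Complex.I * ν') by rw [hBdef]; push_cast; ring,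
    show β + β' + (s - 2) + 3 / 2 - Complex.I * ν' = ((1 : ℝ) : ℂ) * s + (B - 1 / 2 - Complex.I * ν') by rw [hBdef]; push_cast; ring]
  rw [show s + (B - 1 / 2 + Complex.I * ν') = ((1 : ℝ) : ℂ) * s + (B - 1 / 2 + Complex.I * ν') by push_cast; ring,
    show s + (B - 1 / 2 - Complex.I * ν') = ((1 : ℝ) : ℂ) * s + (B - 1 / 2 - Complex.I * ν') by push_cast; ring]
  have h2z' : (2 : ℂ) ^ (β + β' + (s - 2) + 3 / 2) = ((2 : ℂ) ^ (((-1 : ℝ) : ℂ) * s + -(B - 1 / 2)))⁻¹ := by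
    rw [← Complex.cpow_neg]; congr 1; rw [hBdef]; push_cast; ring
  rw [h2z']
  have h2ne : (2 : ℂ) ^ (((-1 : ℝ) : ℂ) * s + -(B - 1 / 2)) ≠ 0 := by
    rw [Ne, Complex.cpow_eq_zero_iff, not_and_or]; exact Or.inl two_ne_zero
  have hΓ' : Complex.Gamma (β + β' + s) ≠ 0 := by
    have e : β + β' + (s - 2) + 3 / 2 + 1 / 2 = β + β' + s := by ring
    rwa [e] at hΓ
  field_simp
  push_cast
  ring_nf
  field_simp

/-- **`K × exp`**: the symmetric form of `rsGammaProduct_local_exp_bessel`. [cite: Jacquet1972GL2II, §17–§19] -/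
theorem rsGammaProduct_local_bessel_exp {β β' ν : ℂ} (h : |ν.im| < (β + β').re + 1 / 2) :
    (∀ s : ℂ, 1 < s.re →
      IntegrableOn (fun u : ℝ => besselShape β (2 * Real.pi) ν u * expShape β' (2 * Real.pi) u * (u : ℂ) ^ (s - 2)) (Ioi 0)) ∧
    ∃ (A : ℂ) (c : ℝ) (d₁ d₂ : ℕ) (a : Fin d₁ → ℂ) (b : Fin d₂ → ℂ), A ≠ 0 ∧ 0 < c ∧ (∀ j, -1 < (a j).re) ∧
      (∀ j, -1 < (b j).re) ∧ ∀ s : ℂ, 1 < s.re →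
        Complex.Gammaℝ (2 * s + 2 * (β + β')) *
            ∫ u in Ioi (0 : ℝ), besselShape β (2 * Real.pi) ν u * expShape β' (2 * Real.pi) u * (u : ℂ) ^ (s - 2) =
          A * (c : ℂ) ^ s * ((∏ j, Complex.Gammaℝ (s + a j)) * ∏ j, Complex.Gammaℂ (s + b j)) := by
  have h' : |ν.im| < (β' + β).re + 1 / 2 := by rwa [add_comm β' β]
  obtain ⟨hint, hΓ⟩ := rsGammaProduct_local_exp_bessel (β := β') (β' := β) (ν' := ν) h'
  have hpt : ∀ s : ℂ, (fun u : ℝ => besselShape β (2 * Real.pi) ν u * expShape β' (2 * Real.pi) u * (u : ℂ) ^ (s - 2)) =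
      fun u : ℝ => expShape β' (2 * Real.pi) u * besselShape β (2 * Real.pi) ν u * (u : ℂ) ^ (s - 2) := fun s => by
    funext u; ring
  refine ⟨fun s hs => by rw [hpt s]; exact hint s hs, rsGammaProduct_congr hΓ fun s _ => ?_⟩
  rw [hpt s, add_comm β β']

/-- **`K × K`** (two principal series at a real place): for `B = β + β'` and `|im ν| + |im ν'| < re B + 1`,
`Γ_ℝ(2s + 2B) ∫₀^∞ u^β k_ν(u) · u^{β'} k_{ν'}(u) · u^{s-2} du = 4 π^{-(s+B)} (2π)^{-(s+B)} 2^{s+B-3}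
∏_{±,±} Γ((s + B ± iν ± iν')/2)` (the factor `Γ(s+B) = Γ(z)` of Tate's integral cancels the denominator of
`integral_besselShape_mul_besselShape_mul_cpow` EXACTLY) is a Rankin–Selberg Gamma product on `re s > 1`
(shifts `B ± iν ± iν'` of real part `> -1`), with integrability. [cite: Jacquet1972GL2II, §17–§19] -/
theorem rsGammaProduct_local_bessel_bessel {β β' ν ν' : ℂ} (h : |ν.im| + |ν'.im| < (β + β').re + 1) :
    (∀ s : ℂ, 1 < s.re →
      IntegrableOn (fun u : ℝ => besselShape β (2 * Real.pi) ν u * besselShape β' (2 * Real.pi) ν' u * (u : ℂ) ^ (s - 2)) (Ioi 0)) ∧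
    ∃ (A : ℂ) (c : ℝ) (d₁ d₂ : ℕ) (a : Fin d₁ → ℂ) (b : Fin d₂ → ℂ), A ≠ 0 ∧ 0 < c ∧ (∀ j, -1 < (a j).re) ∧
      (∀ j, -1 < (b j).re) ∧ ∀ s : ℂ, 1 < s.re →
        Complex.Gammaℝ (2 * s + 2 * (β + β')) *
            ∫ u in Ioi (0 : ℝ), besselShape β (2 * Real.pi) ν u * besselShape β' (2 * Real.pi) ν' u * (u : ℂ) ^ (s - 2) =
          A * (c : ℂ) ^ s * ((∏ j, Complex.Gammaℝ (s + a j)) * ∏ j, Complex.Gammaℂ (s + b j)) := by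
  set B : ℂ := β + β' with hBdef
  have h2π : (0 : ℝ) < 2 * Real.pi := by positivity
  have h0 : 0 ≤ |ν.im| := abs_nonneg _
  have h0' : 0 ≤ |ν'.im| := abs_nonneg _
  have hz : ∀ s : ℂ, 1 < s.re → |ν.im| + |ν'.im| < (β + β' + (s - 2) + 2).re := fun s hs => by
    have e : (β + β' + (s - 2) + 2).re = B.re + s.re := by
      rw [hBdef]; simp only [Complex.add_re, Complex.sub_re, Complex.re_ofNat]; ring
    rw [e]; linarith
  refine ⟨fun s hs => (integral_besselShape_mul_besselShape_mul_cpow h2π (hz s hs)).1, ?_⟩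
  have hνle := le_abs_self ν.im
  have hνge := neg_abs_le ν.im
  have hν'le := le_abs_self ν'.im
  have hν'ge := neg_abs_le ν'.im
  have ha1 : -1 < (B + Complex.I * ν + Complex.I * ν').re := by
    simp only [Complex.add_re, Complex.mul_re, Complex.I_re, Complex.I_im, zero_mul, one_mul, zero_sub]; linarith
  have ha2 : -1 < (B + Complex.I * ν - Complex.I * ν').re := by
    simp only [Complex.add_re, Complex.sub_re, Complex.mul_re, Complex.I_re, Complex.I_im, zero_mul, one_mul, zero_sub]; linarith
  have ha3 : -1 < (B - Complex.I * ν + Complex.I * ν').re := by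
    simp only [Complex.add_re, Complex.sub_re, Complex.mul_re, Complex.I_re, Complex.I_im, zero_mul, one_mul, zero_sub]; linarith
  have ha4 : -1 < (B - Complex.I * ν - Complex.I * ν').re := by
    simp only [Complex.sub_re, Complex.mul_re, Complex.I_re, Complex.I_im, zero_mul, one_mul, zero_sub]; linarith
  refine rsGammaProduct_congr (rsGammaProduct_mul (rsGammaProduct_mul (rsGammaProduct_mul (rsGammaProduct_mul
    (rsGammaProduct_mul (rsGammaProduct_mul
    (rsGammaProduct_const_mul_cpow (A := 4) (by norm_num) Real.pi_pos (-1) (-B))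
    (rsGammaProduct_const_mul_cpow one_ne_zero h2π (-1) (-B)))
    (rsGammaProduct_const_mul_cpow one_ne_zero two_pos 1 (B - 3)))
    (rsGammaProduct_Gamma_half_shift ha1)) (rsGammaProduct_Gamma_half_shift ha2))
    (rsGammaProduct_Gamma_half_shift ha3)) (rsGammaProduct_Gamma_half_shift ha4)) fun s hs => ?_
  rw [(integral_besselShape_mul_besselShape_mul_cpow h2π (hz s hs)).2, Complex.Gammaℝ_def]
  have hΓ : Complex.Gamma (β + β' + s) ≠ 0 := by
    apply Complex.Gamma_ne_zero_of_re_pos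
    have e : (β + β' + s).re = B.re + s.re := by rw [hBdef]; simp only [Complex.add_re]
    rw [e]; linarith
  rw [show (2 * s + 2 * B) / 2 = β + β' + (s - 2) + 2 by rw [hBdef]; ring,
    show -(2 * s + 2 * B) / 2 = ((-1 : ℝ) : ℂ) * s + -B by push_cast; ring,
    show -(β + β' + (s - 2) + 2) = ((-1 : ℝ) : ℂ) * s + -B by rw [hBdef]; push_cast; ring,
    show β + β' + (s - 2) + 2 - 3 = ((1 : ℝ) : ℂ) * s + (B - 3) by rw [hBdef]; push_cast; ring,
    show (β + β' + (s - 2) + 2 + Complex.I * ν + Complex.I * ν') / 2 = (s + (B + Complex.I * ν + Complex.I * ν')) / 2 by rw [hBdef]; ring,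
    show (β + β' + (s - 2) + 2 + Complex.I * ν - Complex.I * ν') / 2 = (s + (B + Complex.I * ν - Complex.I * ν')) / 2 by rw [hBdef]; ring,
    show (β + β' + (s - 2) + 2 - Complex.I * ν + Complex.I * ν') / 2 = (s + (B - Complex.I * ν + Complex.I * ν')) / 2 by rw [hBdef]; ring,
    show (β + β' + (s - 2) + 2 - Complex.I * ν - Complex.I * ν') / 2 = (s + (B - Complex.I * ν - Complex.I * ν')) / 2 by rw [hBdef]; ring,
    show β + β' + (s - 2) + 2 = β + β' + s by ring]
  field_simp
  push_cast
  ring_nf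

end HalfLine

/-! ### 3. The local product at a complex place: `(π/2) 2^{2s+q/2} Γ_ℂ(2s + q/2) · ∫_ℂ G(z) (|z|²)^{s-2} dz`,
`q = 2B - 2` -/

section ComplexPlace

/-- **Radial `K × K` at a complex place**: for `B = β + β'`, `q = 2B - 2` and `|im ν| + |im ν'| < re B + 1`,
`(π/2) 2^{2s+q/2} Γ_ℂ(2s + q/2) · ∫_ℂ |z|^β k_ν(|z|) |z|^{β'} k_{ν'}(|z|) (|z|²)^{s-2} dz
= A · c^s ∏_{±,±} Γ(s + (B - 1 ± iν ± iν')/2)` (`Γ_ℂ(2s + q/2) = Γ_ℂ(z')`, `z' = 2s + B - 1`, cancels the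
denominator `Γ(z')` of `integral_complex_besselShape_mul_besselShape` EXACTLY) is a Rankin–Selberg Gamma
product on `re s > 1` (shifts of real part `> -1`), with integrability. [cite: Jacquet1972GL2II, §17–§19] -/
theorem rsGammaProduct_local_complex {β β' ν ν' : ℂ} (h : |ν.im| + |ν'.im| < (β + β').re + 1) :
    (∀ s : ℂ, 1 < s.re → Integrable (fun x : ℂ => besselShape β (4 * Real.pi) ν ‖x‖ * besselShape β' (4 * Real.pi) ν' ‖x‖ *
        ((‖x‖ ^ 2 : ℝ) : ℂ) ^ (s - 2))) ∧
    ∃ (A : ℂ) (c : ℝ) (d₁ d₂ : ℕ) (a : Fin d₁ → ℂ) (b : Fin d₂ → ℂ), A ≠ 0 ∧ 0 < c ∧ (∀ j, -1 < (a j).re) ∧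
      (∀ j, -1 < (b j).re) ∧ ∀ s : ℂ, 1 < s.re →
        ((Real.pi / 2 : ℂ) * (2 : ℂ) ^ (2 * s + (2 * (β + β') - 2) / 2) * Complex.Gammaℂ (2 * s + (2 * (β + β') - 2) / 2)) *
            ∫ x : ℂ, besselShape β (4 * Real.pi) ν ‖x‖ * besselShape β' (4 * Real.pi) ν' ‖x‖ * ((‖x‖ ^ 2 : ℝ) : ℂ) ^ (s - 2) =
          A * (c : ℂ) ^ s * ((∏ j, Complex.Gammaℝ (s + a j)) * ∏ j, Complex.Gammaℂ (s + b j)) := by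
  set B : ℂ := β + β' with hBdef
  have h4π : (0 : ℝ) < 4 * Real.pi := by positivity
  have h2π : (0 : ℝ) < 2 * Real.pi := by positivity
  have h0 : 0 ≤ |ν.im| := abs_nonneg _
  have h0' : 0 ≤ |ν'.im| := abs_nonneg _
  have hz : ∀ s : ℂ, 1 < s.re → |ν.im| + |ν'.im| < (β + β' + 2 * (s - 2) + 3).re := fun s hs => by
    have e : (β + β' + 2 * (s - 2) + 3).re = B.re + 2 * s.re - 1 := by
      rw [hBdef]; simp only [Complex.add_re, Complex.sub_re, Complex.mul_re, Complex.re_ofNat, Complex.im_ofNat, zero_mul,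
        sub_zero]; ring
    rw [e]; linarith
  refine ⟨fun s hs => (integral_complex_besselShape_mul_besselShape h4π (hz s hs)).1, ?_⟩
  have hνle := le_abs_self ν.im
  have hνge := neg_abs_le ν.im
  have hν'le := le_abs_self ν'.im
  have hν'ge := neg_abs_le ν'.im
  have hb1 : -1 < ((B - 1 + Complex.I * ν + Complex.I * ν') / 2).re := by
    simp only [Complex.div_ofNat_re, Complex.add_re, Complex.sub_re, Complex.mul_re, Complex.I_re, Complex.I_im,
      Complex.one_re, zero_mul, one_mul, zero_sub]; linarith
  have hb2 : -1 < ((B - 1 + Complex.I * ν - Complex.I * ν') / 2).re := by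
    simp only [Complex.div_ofNat_re, Complex.add_re, Complex.sub_re, Complex.mul_re, Complex.I_re, Complex.I_im,
      Complex.one_re, zero_mul, one_mul, zero_sub]; linarith
  have hb3 : -1 < ((B - 1 - Complex.I * ν + Complex.I * ν') / 2).re := by
    simp only [Complex.div_ofNat_re, Complex.add_re, Complex.sub_re, Complex.mul_re, Complex.I_re, Complex.I_im,
      Complex.one_re, zero_mul, one_mul, zero_sub]; linarith
  have hb4 : -1 < ((B - 1 - Complex.I * ν - Complex.I * ν') / 2).re := by
    simp only [Complex.div_ofNat_re, Complex.sub_re, Complex.mul_re, Complex.I_re, Complex.I_im,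
      Complex.one_re, zero_mul, one_mul, zero_sub]; linarith
  have hA : ((Real.pi / 2 : ℂ) * 2 * (2 * Real.pi) * 4) ≠ 0 := by
    have hπ : (Real.pi : ℂ) ≠ 0 := by exact_mod_cast Real.pi_pos.ne'
    refine mul_ne_zero (mul_ne_zero (mul_ne_zero (div_ne_zero hπ two_ne_zero) two_ne_zero)
      (mul_ne_zero two_ne_zero hπ)) (by norm_num)
  refine rsGammaProduct_congr (rsGammaProduct_mul (rsGammaProduct_mul (rsGammaProduct_mul (rsGammaProduct_mul
    (rsGammaProduct_mul (rsGammaProduct_mul (rsGammaProduct_mul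
    (rsGammaProduct_const_mul_cpow hA two_pos 2 (B - 1))
    (rsGammaProduct_const_mul_cpow one_ne_zero h2π (-2) (-(B - 1))))
    (rsGammaProduct_const_mul_cpow one_ne_zero h4π (-2) (-(B - 1))))
    (rsGammaProduct_const_mul_cpow one_ne_zero two_pos 2 (B - 4)))
    (rsGammaProduct_Gamma_shift hb1)) (rsGammaProduct_Gamma_shift hb2))
    (rsGammaProduct_Gamma_shift hb3)) (rsGammaProduct_Gamma_shift hb4)) fun s hs => ?_
  rw [(integral_complex_besselShape_mul_besselShape h4π (hz s hs)).2, Complex.Gammaℂ_def]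
  have hΓ : Complex.Gamma (β + β' + 2 * s - 1) ≠ 0 := by
    apply Complex.Gamma_ne_zero_of_re_pos
    have e : (β + β' + 2 * s - 1).re = B.re + 2 * s.re - 1 := by
      rw [hBdef]; simp only [Complex.add_re, Complex.sub_re, Complex.mul_re, Complex.re_ofNat, Complex.im_ofNat, zero_mul,
        sub_zero, Complex.one_re]
    rw [e]; linarith
  rw [show 2 * s + (2 * B - 2) / 2 = ((2 : ℝ) : ℂ) * s + (B - 1) by rw [hBdef]; push_cast; ring,
    show -(((2 : ℝ) : ℂ) * s + (B - 1)) = ((-2 : ℝ) : ℂ) * s + -(B - 1) by push_cast; ring,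
    show -(β + β' + 2 * (s - 2) + 3) = ((-2 : ℝ) : ℂ) * s + -(B - 1) by rw [hBdef]; push_cast; ring,
    show β + β' + 2 * (s - 2) + 3 - 3 = ((2 : ℝ) : ℂ) * s + (B - 4) by rw [hBdef]; push_cast; ring,
    show (β + β' + 2 * (s - 2) + 3 + Complex.I * ν + Complex.I * ν') / 2 = s + (B - 1 + Complex.I * ν + Complex.I * ν') / 2 by rw [hBdef]; ring,
    show (β + β' + 2 * (s - 2) + 3 + Complex.I * ν - Complex.I * ν') / 2 = s + (B - 1 + Complex.I * ν - Complex.I * ν') / 2 by rw [hBdef]; ring,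
    show (β + β' + 2 * (s - 2) + 3 - Complex.I * ν + Complex.I * ν') / 2 = s + (B - 1 - Complex.I * ν + Complex.I * ν') / 2 by rw [hBdef]; ring,
    show (β + β' + 2 * (s - 2) + 3 - Complex.I * ν - Complex.I * ν') / 2 = s + (B - 1 - Complex.I * ν - Complex.I * ν') / 2 by rw [hBdef]; ring,
    show β + β' + 2 * (s - 2) + 3 = β + β' + 2 * s - 1 by ring,
    show ((2 : ℝ) : ℂ) * s + (B - 1) = β + β' + 2 * s - 1 by rw [hBdef]; push_cast; ring]
  rw [show ((2 * Real.pi : ℝ) : ℂ) = 2 * Real.pi by push_cast; rfl]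
  field_simp
  push_cast
  ring_nf

end ComplexPlace

/-! ### 4. From profiles to the shape functions of the tagged test vectors -/

section Shapes

/-- Two profiles agreeing on `(0, ∞)` define the same real shape function. [folklore] -/
theorem realShapeFn_congr {cp cm : ℂ} {Φ Ψ : ℝ → ℂ} (h : ∀ u : ℝ, 0 < u → Φ u = Ψ u) :
    realShapeFn cp cm Φ = realShapeFn cp cm Ψ := by
  funext t
  rcases lt_trichotomy t 0 with ht | rfl | ht
  · rw [realShapeFn_of_neg cp cm Φ ht, realShapeFn_of_neg cp cm Ψ ht, h (-t) (by linarith)]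
  · rw [realShapeFn_zero, realShapeFn_zero]
  · rw [realShapeFn_of_pos cp cm Φ ht, realShapeFn_of_pos cp cm Ψ ht, h t ht]

/-- **Real place: from the profile product to `F(x) = S(x) conj S'(x)`** for two real shape functions
`S = realShapeFn c₊ c₋ Φ`, `S' = realShapeFn c'₊ c'₋ Φ'` whose profile product `Φ conj Φ' = Ψ` on `(0,∞)` has
`Γ_ℝ(2s+2B) ∫₀^∞ Ψ u^{s-2}` a Rankin–Selberg Gamma product: then so is `Γ_ℝ(2s+2B) ∫_ℝ F(x) |x|^{s-2} dx
= (c₊ conj c'₊ + c₋ conj c'₋) Γ_ℝ(2s+2B) ∫₀^∞ Ψ u^{s-2}` (`integral_realShapeFn_mul`), provided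
`c₊ conj c'₊ + c₋ conj c'₋ ≠ 0`, with integrability. [cite: Jacquet1972GL2II, §17–§19] -/
theorem rsGammaProduct_local_realShapeFn {cp cm cp' cm' B : ℂ} {Φ Φ' Ψ : ℝ → ℂ}
    (hc : cp * conj cp' + cm * conj cm' ≠ 0) (hΨ : ∀ u : ℝ, 0 < u → Φ u * conj (Φ' u) = Ψ u)
    (hcore : (∀ s : ℂ, 1 < s.re → IntegrableOn (fun u : ℝ => Ψ u * (u : ℂ) ^ (s - 2)) (Ioi 0)) ∧
      ∃ (A : ℂ) (c : ℝ) (d₁ d₂ : ℕ) (a : Fin d₁ → ℂ) (b : Fin d₂ → ℂ), A ≠ 0 ∧ 0 < c ∧ (∀ j, -1 < (a j).re) ∧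
        (∀ j, -1 < (b j).re) ∧ ∀ s : ℂ, 1 < s.re →
          Complex.Gammaℝ (2 * s + 2 * B) * ∫ u in Ioi (0 : ℝ), Ψ u * (u : ℂ) ^ (s - 2) =
            A * (c : ℂ) ^ s * ((∏ j, Complex.Gammaℝ (s + a j)) * ∏ j, Complex.Gammaℂ (s + b j))) :
    (∀ s : ℂ, 1 < s.re → Integrable (fun x : ℝ =>
      realShapeFn cp cm Φ x * conj (realShapeFn cp' cm' Φ' x) * ((|x| : ℝ) : ℂ) ^ (s - 2))) ∧
    ∃ (A : ℂ) (c : ℝ) (d₁ d₂ : ℕ) (a : Fin d₁ → ℂ) (b : Fin d₂ → ℂ), A ≠ 0 ∧ 0 < c ∧ (∀ j, -1 < (a j).re) ∧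
      (∀ j, -1 < (b j).re) ∧ ∀ s : ℂ, 1 < s.re →
        Complex.Gammaℝ (2 * s + 2 * B) * ∫ x : ℝ, realShapeFn cp cm Φ x * conj (realShapeFn cp' cm' Φ' x) * ((|x| : ℝ) : ℂ) ^ (s - 2) =
          A * (c : ℂ) ^ s * ((∏ j, Complex.Gammaℝ (s + a j)) * ∏ j, Complex.Gammaℂ (s + b j)) := by
  obtain ⟨hint, hΓ⟩ := hcore
  have hpt : ∀ x : ℝ, realShapeFn cp cm Φ x * conj (realShapeFn cp' cm' Φ' x) =
      realShapeFn (cp * conj cp') (cm * conj cm') Ψ x := fun x => by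
    rw [conj_realShapeFn, realShapeFn_mul_realShapeFn, realShapeFn_congr (Φ := fun u => Φ u * conj (Φ' u)) (Ψ := Ψ) hΨ]
  simp_rw [hpt]
  refine ⟨fun s hs => integrable_realShapeFn_mul _ _ _ (hint s hs), ?_⟩
  refine rsGammaProduct_congr (rsGammaProduct_mul (rsGammaProduct_const hc) hΓ) fun s hs => ?_
  rw [integral_realShapeFn_mul _ _ _ (hint s hs)]
  ring

/-- **Complex place: from the profile product to `G(z) = S(z) conj S'(z)`** for two radial Bessel shapes:
`conj (|z|^{β'} k_{ν'}(|z|)) = |z|^{conj β'} k_{conj ν'}(|z|)` off `z = 0`, so with `B = β + conj β'` and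
`|im ν| + |im ν'| < re B + 1` the local product is a Rankin–Selberg Gamma product
(`rsGammaProduct_local_complex`), with integrability. [cite: Jacquet1972GL2II, §17–§19] -/
theorem rsGammaProduct_local_complex_conj {β β' ν ν' : ℂ} (h : |ν.im| + |ν'.im| < (β + conj β').re + 1) :
    (∀ s : ℂ, 1 < s.re → Integrable (fun x : ℂ => besselShape β (4 * Real.pi) ν ‖x‖ * conj (besselShape β' (4 * Real.pi) ν' ‖x‖) *
        ((‖x‖ ^ 2 : ℝ) : ℂ) ^ (s - 2))) ∧
    ∃ (A : ℂ) (c : ℝ) (d₁ d₂ : ℕ) (a : Fin d₁ → ℂ) (b : Fin d₂ → ℂ), A ≠ 0 ∧ 0 < c ∧ (∀ j, -1 < (a j).re) ∧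
      (∀ j, -1 < (b j).re) ∧ ∀ s : ℂ, 1 < s.re →
        ((Real.pi / 2 : ℂ) * (2 : ℂ) ^ (2 * s + (2 * (β + conj β') - 2) / 2) * Complex.Gammaℂ (2 * s + (2 * (β + conj β') - 2) / 2)) *
            ∫ x : ℂ, besselShape β (4 * Real.pi) ν ‖x‖ * conj (besselShape β' (4 * Real.pi) ν' ‖x‖) * ((‖x‖ ^ 2 : ℝ) : ℂ) ^ (s - 2) =
          A * (c : ℂ) ^ s * ((∏ j, Complex.Gammaℝ (s + a j)) * ∏ j, Complex.Gammaℂ (s + b j)) := by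
  have h4π : (0 : ℝ) < 4 * Real.pi := by positivity
  have h' : |ν.im| + |(conj ν').im| < (β + conj β').re + 1 := by rwa [Complex.conj_im, abs_neg]
  obtain ⟨hint, hΓ⟩ := rsGammaProduct_local_complex (β := β) (β' := conj β') (ν := ν) (ν' := conj ν') h'
  have hae : ∀ s : ℂ, (fun x : ℂ => besselShape β (4 * Real.pi) ν ‖x‖ * conj (besselShape β' (4 * Real.pi) ν' ‖x‖) *
        ((‖x‖ ^ 2 : ℝ) : ℂ) ^ (s - 2)) =ᵐ[volume]
      fun x : ℂ => besselShape β (4 * Real.pi) ν ‖x‖ * besselShape (conj β') (4 * Real.pi) (conj ν') ‖x‖ * ((‖x‖ ^ 2 : ℝ) : ℂ) ^ (s - 2) := by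
    intro s
    have h0 : ∀ᵐ x : ℂ ∂volume, x ≠ 0 := by
      have : (volume : Measure ℂ) {0} = 0 := measure_singleton 0
      rw [ae_iff]
      simpa only [ne_eq, not_not, setOf_eq_eq_singleton] using this
    filter_upwards [h0] with x hx
    rw [conj_besselShape h4π (norm_pos_iff.mpr hx)]
  refine ⟨fun s hs => (hint s hs).congr (hae s).symm, rsGammaProduct_congr hΓ fun s _ => ?_⟩
  rw [integral_congr_ae (hae s)]

/-- **The local Gamma identity at a REAL place for a pair of tagged shape functions.** For tags `t, t'`
(`ArchHeckeTestVectorConstructionGL2.realShapeOf`) with purely imaginary central scalars `μ, μ'` and the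
unitarity bounds (`ArchUnitarityBoundsGL2Real`: `re κ = 0` for `weightOneSym κ`, `|im ν| < ½` for the weight-zero
tags), the exponents `β(t) ∈ {(μ+k)/2, (μ+1)/2, μ/2, μ/2+1}` of the shapes and `B = β(t) + conj β(t')`:
`Γ_ℝ(2s + 2B) · ∫_ℝ S_t(x) conj S'_{t'}(x) |x|^{s-2} dx` is a Rankin–Selberg Gamma product on `re s > 1`
(Tate's factor `Γ_ℝ(2s + 2B)` is that of the weight polynomial of degree `p + p'`, `β = (μ+p)/2`), with
integrability — all sixteen pairs of tags (`exp × exp`, `exp × K`, `K × K`). [cite: Jacquet1972GL2II, §17–§19]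
[cite: HumphriesJo2024, Thm. 5.6 and Prop. 5.8] -/
theorem rsGammaProduct_local_realTag (μ ν : ℂ) (t : RealTag) (μ' ν' : ℂ) (t' : RealTag) (hμ : μ.re = 0) (hμ' : μ'.re = 0)
    (ht : match t with
      | .discPlus k => 1 ≤ k
      | .weightOneSym κ => κ.re = 0
      | .weightZero => |ν.im| < 1 / 2
      | .weightZeroX => |ν.im| < 1 / 2)
    (ht' : match t' with
      | .discPlus k => 1 ≤ k
      | .weightOneSym κ => κ.re = 0
      | .weightZero => |ν'.im| < 1 / 2
      | .weightZeroX => |ν'.im| < 1 / 2) :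
    (∀ s : ℂ, 1 < s.re → Integrable (fun x : ℝ =>
      realShapeOf μ ν t x * conj (realShapeOf μ' ν' t' x) * ((|x| : ℝ) : ℂ) ^ (s - 2))) ∧
    ∃ (A : ℂ) (c : ℝ) (d₁ d₂ : ℕ) (a : Fin d₁ → ℂ) (b : Fin d₂ → ℂ), A ≠ 0 ∧ 0 < c ∧ (∀ j, -1 < (a j).re) ∧
      (∀ j, -1 < (b j).re) ∧ ∀ s : ℂ, 1 < s.re →
        Complex.Gammaℝ (2 * s + 2 * ((match t with
            | .discPlus k => (μ + k) / 2
            | .weightOneSym _ => (μ + 1) / 2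
            | .weightZero => μ / 2
            | .weightZeroX => μ / 2 + 1) + conj (match t' with
            | .discPlus k => (μ' + k) / 2
            | .weightOneSym _ => (μ' + 1) / 2
            | .weightZero => μ' / 2
            | .weightZeroX => μ' / 2 + 1))) *
          ∫ x : ℝ, realShapeOf μ ν t x * conj (realShapeOf μ' ν' t' x) * ((|x| : ℝ) : ℂ) ^ (s - 2) =
          A * (c : ℂ) ^ s * ((∏ j, Complex.Gammaℝ (s + a j)) * ∏ j, Complex.Gammaℂ (s + b j)) := by
  have h2π : (0 : ℝ) < 2 * Real.pi := by positivity
  have hν0 : 0 ≤ |ν.im| := abs_nonneg _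
  have hν'0 : 0 ≤ |ν'.im| := abs_nonneg _
  -- the conjugated profiles on `(0, ∞)`
  have cexp : ∀ (β' : ℂ) (u : ℝ), 0 < u → conj (expShape β' (2 * Real.pi) u) = expShape (conj β') (2 * Real.pi) u :=
    fun β' u hu => conj_expShape hu.le β' _
  have cbes : ∀ (β' ν'' : ℂ) (u : ℝ), 0 < u → conj (besselShape β' (2 * Real.pi) ν'' u) = besselShape (conj β') (2 * Real.pi) (conj ν'') u :=
    fun β' ν'' u hu => conj_besselShape h2π hu β' ν''
  cases t with
  | discPlus k =>
    have hk : (1 : ℝ) ≤ k := by exact_mod_cast ht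
    cases t' with
    | discPlus k' =>
      have hk' : (1 : ℝ) ≤ k' := by exact_mod_cast ht'
      refine rsGammaProduct_local_realShapeFn (by simp) (fun u hu => by rw [cexp _ u hu]) (rsGammaProduct_local_exp_exp ?_)
      simp only [Complex.add_re, Complex.conj_re, Complex.div_ofNat_re, Complex.natCast_re, hμ, hμ']
      linarith
    | weightOneSym κ' =>
      refine rsGammaProduct_local_realShapeFn (by simp) (fun u hu => by rw [cbes _ _ u hu]) (rsGammaProduct_local_exp_bessel ?_)
      have hκ' : κ'.re = 0 := ht'
      have hνe' : |(conj (Complex.I * (κ' - 1 / 2))).im| = 1 / 2 := by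
        simp only [Complex.conj_im, abs_neg, Complex.mul_im, Complex.I_re, Complex.I_im, Complex.sub_re, Complex.one_re, hκ',
          zero_mul, one_mul, Complex.div_ofNat_re, zero_add]
        norm_num
      rw [hνe']
      simp only [Complex.add_re, Complex.conj_re, Complex.div_ofNat_re, Complex.natCast_re, hμ, hμ', Complex.one_re]
      linarith
    | weightZero =>
      refine rsGammaProduct_local_realShapeFn (by simp) (fun u hu => by rw [cbes _ _ u hu]) (rsGammaProduct_local_exp_bessel ?_)
      have hb : |ν'.im| < 1 / 2 := ht'
      simp only [Complex.add_re, Complex.conj_re, Complex.conj_im, Complex.div_ofNat_re, Complex.natCast_re, hμ, hμ', abs_neg]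
      linarith
    | weightZeroX =>
      refine rsGammaProduct_local_realShapeFn (by simp) (fun u hu => by rw [cbes _ _ u hu]) (rsGammaProduct_local_exp_bessel ?_)
      have hb : |ν'.im| < 1 / 2 := ht'
      simp only [Complex.add_re, Complex.conj_re, Complex.conj_im, Complex.div_ofNat_re, Complex.natCast_re, hμ, hμ', abs_neg,
        Complex.one_re]
      linarith
  | weightOneSym κ =>
    have hκ : κ.re = 0 := ht
    have hνe : |(Complex.I * (κ - 1 / 2)).im| = 1 / 2 := by
      simp only [Complex.mul_im, Complex.I_re, Complex.I_im, Complex.sub_re, Complex.one_re, hκ, zero_mul, one_mul,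
        Complex.div_ofNat_re, zero_add]
      norm_num
    cases t' with
    | discPlus k' =>
      have hk' : (1 : ℝ) ≤ k' := by exact_mod_cast ht'
      refine rsGammaProduct_local_realShapeFn (by simp) (fun u hu => by rw [cexp _ u hu]) (rsGammaProduct_local_bessel_exp ?_)
      rw [hνe]
      simp only [Complex.add_re, Complex.conj_re, Complex.div_ofNat_re, Complex.natCast_re, hμ, hμ', Complex.one_re]
      linarith
    | weightOneSym κ' =>
      have hκ' : κ'.re = 0 := ht'
      have hνe' : |(conj (Complex.I * (κ' - 1 / 2))).im| = 1 / 2 := by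
        simp only [Complex.conj_im, abs_neg, Complex.mul_im, Complex.I_re, Complex.I_im, Complex.sub_re, Complex.one_re, hκ',
          zero_mul, one_mul, Complex.div_ofNat_re, zero_add]
        norm_num
      refine rsGammaProduct_local_realShapeFn (by norm_num) (fun u hu => by rw [cbes _ _ u hu]) (rsGammaProduct_local_bessel_bessel ?_)
      rw [hνe, hνe']
      simp only [Complex.add_re, Complex.conj_re, Complex.div_ofNat_re, hμ, hμ', Complex.one_re]
      norm_num
    | weightZero =>
      have hb : |ν'.im| < 1 / 2 := ht'
      refine rsGammaProduct_local_realShapeFn (by norm_num) (fun u hu => by rw [cbes _ _ u hu]) (rsGammaProduct_local_bessel_bessel ?_)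
      rw [hνe, Complex.conj_im, abs_neg]
      simp only [Complex.add_re, Complex.conj_re, Complex.div_ofNat_re, hμ, hμ', Complex.one_re]
      linarith
    | weightZeroX =>
      have hb : |ν'.im| < 1 / 2 := ht'
      refine rsGammaProduct_local_realShapeFn (by norm_num) (fun u hu => by rw [cbes _ _ u hu]) (rsGammaProduct_local_bessel_bessel ?_)
      rw [hνe, Complex.conj_im, abs_neg]
      simp only [Complex.add_re, Complex.conj_re, Complex.div_ofNat_re, hμ, hμ', Complex.one_re]
      linarith
  | weightZero =>
    have hb0 : |ν.im| < 1 / 2 := ht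
    cases t' with
    | discPlus k' =>
      have hk' : (1 : ℝ) ≤ k' := by exact_mod_cast ht'
      refine rsGammaProduct_local_realShapeFn (by simp) (fun u hu => by rw [cexp _ u hu]) (rsGammaProduct_local_bessel_exp ?_)
      simp only [Complex.add_re, Complex.conj_re, Complex.div_ofNat_re, Complex.natCast_re, hμ, hμ']
      linarith
    | weightOneSym κ' =>
      have hκ' : κ'.re = 0 := ht'
      have hνe' : |(conj (Complex.I * (κ' - 1 / 2))).im| = 1 / 2 := by
        simp only [Complex.conj_im, abs_neg, Complex.mul_im, Complex.I_re, Complex.I_im, Complex.sub_re, Complex.one_re, hκ',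
          zero_mul, one_mul, Complex.div_ofNat_re, zero_add]
        norm_num
      refine rsGammaProduct_local_realShapeFn (by norm_num) (fun u hu => by rw [cbes _ _ u hu]) (rsGammaProduct_local_bessel_bessel ?_)
      rw [hνe']
      simp only [Complex.add_re, Complex.conj_re, Complex.div_ofNat_re, hμ, hμ', Complex.one_re]
      linarith
    | weightZero =>
      have hb : |ν'.im| < 1 / 2 := ht'
      refine rsGammaProduct_local_realShapeFn (by norm_num) (fun u hu => by rw [cbes _ _ u hu]) (rsGammaProduct_local_bessel_bessel ?_)
      rw [Complex.conj_im, abs_neg]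
      simp only [Complex.add_re, Complex.conj_re, Complex.div_ofNat_re, hμ, hμ']
      linarith
    | weightZeroX =>
      have hb : |ν'.im| < 1 / 2 := ht'
      refine rsGammaProduct_local_realShapeFn (by norm_num) (fun u hu => by rw [cbes _ _ u hu]) (rsGammaProduct_local_bessel_bessel ?_)
      rw [Complex.conj_im, abs_neg]
      simp only [Complex.add_re, Complex.conj_re, Complex.div_ofNat_re, hμ, hμ', Complex.one_re]
      linarith
  | weightZeroX =>
    have hb0 : |ν.im| < 1 / 2 := ht
    cases t' with
    | discPlus k' =>
      have hk' : (1 : ℝ) ≤ k' := by exact_mod_cast ht'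
      refine rsGammaProduct_local_realShapeFn (by simp) (fun u hu => by rw [cexp _ u hu]) (rsGammaProduct_local_bessel_exp ?_)
      simp only [Complex.add_re, Complex.conj_re, Complex.div_ofNat_re, Complex.natCast_re, hμ, hμ', Complex.one_re]
      linarith
    | weightOneSym κ' =>
      have hκ' : κ'.re = 0 := ht'
      have hνe' : |(conj (Complex.I * (κ' - 1 / 2))).im| = 1 / 2 := by
        simp only [Complex.conj_im, abs_neg, Complex.mul_im, Complex.I_re, Complex.I_im, Complex.sub_re, Complex.one_re, hκ',
          zero_mul, one_mul, Complex.div_ofNat_re, zero_add]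
        norm_num
      refine rsGammaProduct_local_realShapeFn (by norm_num) (fun u hu => by rw [cbes _ _ u hu]) (rsGammaProduct_local_bessel_bessel ?_)
      rw [hνe']
      simp only [Complex.add_re, Complex.conj_re, Complex.div_ofNat_re, hμ, hμ', Complex.one_re]
      linarith
    | weightZero =>
      have hb : |ν'.im| < 1 / 2 := ht'
      refine rsGammaProduct_local_realShapeFn (by norm_num) (fun u hu => by rw [cbes _ _ u hu]) (rsGammaProduct_local_bessel_bessel ?_)
      rw [Complex.conj_im, abs_neg]
      simp only [Complex.add_re, Complex.conj_re, Complex.div_ofNat_re, hμ, hμ', Complex.one_re]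
      linarith
    | weightZeroX =>
      have hb : |ν'.im| < 1 / 2 := ht'
      refine rsGammaProduct_local_realShapeFn (by norm_num) (fun u hu => by rw [cbes _ _ u hu]) (rsGammaProduct_local_bessel_bessel ?_)
      rw [Complex.conj_im, abs_neg]
      simp only [Complex.add_re, Complex.conj_re, Complex.div_ofNat_re, hμ, hμ', Complex.one_re]
      linarith

/-- **The local Gamma identity at a COMPLEX place for a pair of tagged shape functions.** For tags `t, t'`
(`ArchHeckeTestVectorConstructionGL2.complexShapeOf`: `|z|^{β(t)} k_{ν(t)}(|z|)` with
`β(t) = (μ₁+m+1)/2 + b` (`holPow b`, `antiPowLowest b`) or `(μ₁+m+1)/2` (`string j`), `ν(t) = ν^a, ν^h, ν^a - ij`),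
purely imaginary `μ₁, μ'₁` and the unitarity bounds (`ArchUnitarityBoundsGL2Complex`: `|im ν^a|, |im ν^h| < m/2+1`,
and `im ν^a = m/2` on strings), with `B = β(t) + conj β(t')` and `q = 2B - 2` (the degree `n + n'` of the weight
polynomial plus the central exponents): `(π/2) 2^{2s+q/2} Γ_ℂ(2s+q/2) · ∫_ℂ S_t(z) conj S'_{t'}(z) (|z|²)^{s-2} dz`
is a Rankin–Selberg Gamma product on `re s > 1`, with integrability — all nine pairs of tags.
[cite: Jacquet1972GL2II, §17–§19] [cite: HumphriesJo2024, Thm. 5.6 and Prop. 5.8] -/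
theorem rsGammaProduct_local_complexTag (μ₁ : ℂ) (m : ℕ) (νa νh : ℂ) (t : ComplexTag) (μ₁' : ℂ) (m' : ℕ) (νa' νh' : ℂ)
    (t' : ComplexTag) (hμ : μ₁.re = 0) (hμ' : μ₁'.re = 0)
    (hνa : |νa.im| < (m : ℝ) / 2 + 1) (hνh : |νh.im| < (m : ℝ) / 2 + 1)
    (hνa' : |νa'.im| < (m' : ℝ) / 2 + 1) (hνh' : |νh'.im| < (m' : ℝ) / 2 + 1)
    (ht : match t with
      | .string j => νa.im = (m : ℝ) / 2 ∧ j ≤ m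
      | _ => True)
    (ht' : match t' with
      | .string j => νa'.im = (m' : ℝ) / 2 ∧ j ≤ m'
      | _ => True) :
    (∀ s : ℂ, 1 < s.re → Integrable (fun x : ℂ =>
      complexShapeOf μ₁ m νa νh t x * conj (complexShapeOf μ₁' m' νa' νh' t' x) * ((‖x‖ ^ 2 : ℝ) : ℂ) ^ (s - 2))) ∧
    ∃ (A : ℂ) (c : ℝ) (d₁ d₂ : ℕ) (a : Fin d₁ → ℂ) (b : Fin d₂ → ℂ), A ≠ 0 ∧ 0 < c ∧ (∀ j, -1 < (a j).re) ∧
      (∀ j, -1 < (b j).re) ∧ ∀ s : ℂ, 1 < s.re →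
        ((Real.pi / 2 : ℂ) * (2 : ℂ) ^ (2 * s + (2 * ((match t with
            | .holPow b => (μ₁ + m + 1) / 2 + b
            | .antiPowLowest b => (μ₁ + m + 1) / 2 + b
            | .string _ => (μ₁ + m + 1) / 2) + conj (match t' with
            | .holPow b => (μ₁' + m' + 1) / 2 + b
            | .antiPowLowest b => (μ₁' + m' + 1) / 2 + b
            | .string _ => (μ₁' + m' + 1) / 2)) - 2) / 2) *
          Complex.Gammaℂ (2 * s + (2 * ((match t with
            | .holPow b => (μ₁ + m + 1) / 2 + b
            | .antiPowLowest b => (μ₁ + m + 1) / 2 + b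
            | .string _ => (μ₁ + m + 1) / 2) + conj (match t' with
            | .holPow b => (μ₁' + m' + 1) / 2 + b
            | .antiPowLowest b => (μ₁' + m' + 1) / 2 + b
            | .string _ => (μ₁' + m' + 1) / 2)) - 2) / 2)) *
          ∫ x : ℂ, complexShapeOf μ₁ m νa νh t x * conj (complexShapeOf μ₁' m' νa' νh' t' x) * ((‖x‖ ^ 2 : ℝ) : ℂ) ^ (s - 2) =
          A * (c : ℂ) ^ s * ((∏ j, Complex.Gammaℝ (s + a j)) * ∏ j, Complex.Gammaℂ (s + b j)) := by
  have hm0 : (0 : ℝ) ≤ m := Nat.cast_nonneg m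
  have hm0' : (0 : ℝ) ≤ m' := Nat.cast_nonneg m'
  -- per side: `|im ν(t)| < re β(t) + ½`
  have side : ∀ (μ₀ : ℂ) (m₀ : ℕ) (νa₀ νh₀ : ℂ) (t₀ : ComplexTag), μ₀.re = 0 → |νa₀.im| < (m₀ : ℝ) / 2 + 1 → |νh₀.im| < (m₀ : ℝ) / 2 + 1 →
      (match t₀ with
        | .string j => νa₀.im = (m₀ : ℝ) / 2 ∧ j ≤ m₀
        | _ => True) →
      |(match t₀ with
        | .holPow _ => νa₀
        | .antiPowLowest _ => νh₀
        | .string j => νa₀ - Complex.I * j).im| <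
        (match t₀ with
          | .holPow b => (μ₀ + m₀ + 1) / 2 + b
          | .antiPowLowest b => (μ₀ + m₀ + 1) / 2 + b
          | .string _ => (μ₀ + m₀ + 1) / 2).re + 1 / 2 := by
    intro μ₀ m₀ νa₀ νh₀ t₀ hμ₀ ha hh ht₀
    cases t₀ with
    | holPow b =>
      have hb : (0 : ℝ) ≤ b := Nat.cast_nonneg b
      simp only [Complex.add_re, Complex.div_ofNat_re, Complex.natCast_re, Complex.one_re, hμ₀]
      linarith
    | antiPowLowest b =>
      have hb : (0 : ℝ) ≤ b := Nat.cast_nonneg b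
      simp only [Complex.add_re, Complex.div_ofNat_re, Complex.natCast_re, Complex.one_re, hμ₀]
      linarith
    | string j =>
      obtain ⟨hstr, hj⟩ := ht₀
      have hj' : (j : ℝ) ≤ m₀ := by exact_mod_cast hj
      have hj0 : (0 : ℝ) ≤ j := Nat.cast_nonneg j
      simp only [Complex.sub_im, Complex.mul_im, Complex.I_re, Complex.I_im, Complex.natCast_re, Complex.natCast_im, zero_mul,
        one_mul, hstr, Complex.add_re, Complex.div_ofNat_re, Complex.one_re, hμ₀]
      rw [abs_lt]
      constructor <;> linarith
  have hs := side μ₁ m νa νh t hμ hνa hνh ht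
  have hs' := side μ₁' m' νa' νh' t' hμ' hνa' hνh' ht'
  -- the bound `|im ν(t)| + |im ν(t')| < re(β(t) + conj β(t')) + 1`
  have key : ∀ {ν₀ ν₀' β₀ β₀' : ℂ}, |ν₀.im| < β₀.re + 1 / 2 → |ν₀'.im| < β₀'.re + 1 / 2 →
      |ν₀.im| + |ν₀'.im| < (β₀ + conj β₀').re + 1 := fun h1 h2 => by
    rw [Complex.add_re, Complex.conj_re]; linarith
  cases t with
  | holPow b =>
    cases t' with
    | holPow b' => exact rsGammaProduct_local_complex_conj (key hs hs')
    | antiPowLowest b' => exact rsGammaProduct_local_complex_conj (key hs hs')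
    | string j' => exact rsGammaProduct_local_complex_conj (key hs hs')
  | antiPowLowest b =>
    cases t' with
    | holPow b' => exact rsGammaProduct_local_complex_conj (key hs hs')
    | antiPowLowest b' => exact rsGammaProduct_local_complex_conj (key hs hs')
    | string j' => exact rsGammaProduct_local_complex_conj (key hs hs')
  | string j =>
    cases t' with
    | holPow b' => exact rsGammaProduct_local_complex_conj (key hs hs')
    | antiPowLowest b' => exact rsGammaProduct_local_complex_conj (key hs hs')
    | string j' => exact rsGammaProduct_local_complex_conj (key hs hs')


end Shapes


end Literature.NumberTheory.Automorphic
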